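import Summits.CriticalPhenomena.PercolationContinuityZ3.Theorems.PercNearOneGluingNoHeavyLowerTailThreePointProductFormHubWordsAll
import Summits.CriticalPhenomena.PercolationContinuityZ3.Theorems.PercNearOneGluingNoHeavyLowerTailThreePointProductFormHubWordsCurveTables
import Mathlib.Tactic.Linarith
import Mathlib.Tactic.NormNum
import Mathlib.Tactic.Ring
import Mathlib.Tactic.Positivity
import HarnessLib

/-!
# Hub words over ℕ, V: THEOREM M, core — the strengthened invariant and the monotonicity of `D` in every letter
# (Sahi programme, prover prim-sahi-p2 gen 64; memo `FROM-prim-sahi-p2-gen64-ABPLUS-PROOF.md` §12)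

Support file (`--supports stmt-CriticalPhenomena-4575`).  Standard axioms, no sorries, no named facts, no new definitions.
STRENGTHENED INVARIANT `Inv⁺(s)`: the invariant of part II (`t ≥ 0`, `aW ≥ 0`, the five generator pairings `≥ 0` for every letter) AND the five
pairings are NONDECREASING in the letter.  It holds at `ω`, is preserved by every letter `M(a)` (`invP_state`, using (P3) `K_i(a,y+1) ≥ K_i(a,y)` of
part IV), by `M(0) − I` (`invP_diff0`) and by every INCREMENT `M(c+1) − M(c)` (`invP_delta`, using (P2), (P4)).  Consequences: the `D₆`-increment
`D₆(Y (c+1) Z) − D₆(Y c Z) = α(Y·(M(c+1)−M(c))·s_Z) ≥ 0` and it does not decrease when bare vertices are inserted into `Y` or `Z`; with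
`6·5^n ≥ 18·4^n` (`n ≥ 5`) this gives `D(Y c Z) ≤ D(Y (c+1) Z)` whenever `Σ ≥ 5` (`D_mono_of_five_le`); part VI finishes `Σ ≤ 4`. [this work]
-/

namespace Summit.CriticalPhenomena.PercolationContinuityZ3.Theorems.ProductFormHubWords

/-- `aW` is linear. [this work] -/
theorem aW_sub (s r : St) : aW (sub s r) = aW s - aW r := by
  simp only [aW, sub]; ring

/-- `pair0` is linear in the state. [this work] -/
theorem pair0_sub (y : ℕ) (s r : St) : pair0 y (sub s r).p1 (sub s r).q1 (sub s r).p2 (sub s r).q2 = pair0 y s.p1 s.q1 s.p2 s.q2 - pair0 y r.p1 r.q1 r.p2 r.q2 := by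
  simp only [pair0, rho, sub]; ring

/-- `pair1` is linear in the state. [this work] -/
theorem pair1_sub (y : ℕ) (s r : St) : pair1 y (sub s r).p1 (sub s r).q1 (sub s r).p2 (sub s r).q2 = pair1 y s.p1 s.q1 s.p2 s.q2 - pair1 y r.p1 r.q1 r.p2 r.q2 := by
  simp only [pair1, rho, sub]; ring

/-- `pair2` is linear in the state. [this work] -/
theorem pair2_sub (y : ℕ) (s r : St) : pair2 y (sub s r).p1 (sub s r).q1 (sub s r).p2 (sub s r).q2 = pair2 y s.p1 s.q1 s.p2 s.q2 - pair2 y r.p1 r.q1 r.p2 r.q2 := by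
  simp only [pair2, rho, sub]; ring

/-- `pair3` is linear in the state. [this work] -/
theorem pair3_sub (y : ℕ) (s r : St) : pair3 y (sub s r).p1 (sub s r).q1 (sub s r).p2 (sub s r).q2 = pair3 y s.p1 s.q1 s.p2 s.q2 - pair3 y r.p1 r.q1 r.p2 r.q2 := by
  simp only [pair3, rho, sub]; ring

/-- `pair4` is linear in the state. [this work] -/
theorem pair4_sub (y : ℕ) (s r : St) : pair4 y (sub s r).p1 (sub s r).q1 (sub s r).p2 (sub s r).q2 = pair4 y s.p1 s.q1 s.p2 s.q2 - pair4 y r.p1 r.q1 r.p2 r.q2 := by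
  simp only [pair4, rho, sub]; ring

/-- `S0` is nondecreasing. [this work] -/
theorem S0_mono (c : ℕ) : S0 c ≤ S0 (c+1) := by
  have h25 : (2:ℚ)^c ≤ (5:ℚ)^c := pow_le_pow_left₀ (by norm_num) (by norm_num) c
  have h2n : (0:ℚ) ≤ (2:ℚ)^c := by positivity
  simp only [S0, pow_succ]; nlinarith

/-- `evalApp` of a concatenation. [this work] -/
theorem evalApp_append (Y1 Y2 : List ℕ) (s : St) : evalApp (Y1 ++ Y2) s = evalApp Y1 (evalApp Y2 s) := by
  induction Y1 with
  | nil => rfl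
  | cons y Y ih => simp only [List.cons_append, evalApp, ih]

/-- The increment operator `M(c+1) − M(c)` is linear. [this work] -/
theorem delta_sub (c : ℕ) (s r : St) :
    sub (step (c+1) (sub s r)) (step c (sub s r)) = sub (sub (step (c+1) s) (step c s)) (sub (step (c+1) r) (step c r)) := by
  simp only [step, sub, St.mk.injEq]
  refine ⟨?_, ?_, ?_, ?_, ?_, ?_⟩ <;> ring

/-- `α = (81/2)t + aW ≥ 0` on every state of the invariant. [this work] -/
theorem alphaF_nonneg_of_invP (s : St) (h : ((0 ≤ s.t ∧ 0 ≤ aW s ∧ ∀ y : ℕ, 0 ≤ pair0 y s.p1 s.q1 s.p2 s.q2 ∧ 0 ≤ pair1 y s.p1 s.q1 s.p2 s.q2 ∧ 0 ≤ pair2 y s.p1 s.q1 s.p2 s.q2 ∧ 0 ≤ pair3 y s.p1 s.q1 s.p2 s.q2 ∧ 0 ≤ pair4 y s.p1 s.q1 s.p2 s.q2) ∧ (∀ y : ℕ, pair0 y s.p1 s.q1 s.p2 s.q2 ≤ pair0 (y+1) s.p1 s.q1 s.p2 s.q2 ∧ pair1 y s.p1 s.q1 s.p2 s.q2 ≤ pair1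 (y+1) s.p1 s.q1 s.p2 s.q2 ∧ pair2 y s.p1 s.q1 s.p2 s.q2 ≤ pair2 (y+1) s.p1 s.q1 s.p2 s.q2 ∧ pair3 y s.p1 s.q1 s.p2 s.q2 ≤ pair3 (y+1) s.p1 s.q1 s.p2 s.q2 ∧ pair4 y s.p1 s.q1 s.p2 s.q2 ≤ pair4 (y+1) s.p1 s.q1 s.p2 s.q2))) : 0 ≤ alphaF s := by
  have e : alphaF s = ((81:ℚ)/2) * s.t + aW s := by simp only [alphaF, aW]; ring
  rw [e]; nlinarith [h.1.1, h.1.2.1]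

/-- `Inv⁺` is preserved by every letter: the pairings of `M(a)s` are again nondecreasing in the letter, by the right-multiplication certificates and (P3). [this work] -/
theorem invP_state (s : St) (h : ((0 ≤ s.t ∧ 0 ≤ aW s ∧ ∀ y : ℕ, 0 ≤ pair0 y s.p1 s.q1 s.p2 s.q2 ∧ 0 ≤ pair1 y s.p1 s.q1 s.p2 s.q2 ∧ 0 ≤ pair2 y s.p1 s.q1 s.p2 s.q2 ∧ 0 ≤ pair3 y s.p1 s.q1 s.p2 s.q2 ∧ 0 ≤ pair4 y s.p1 s.q1 s.p2 s.q2) ∧ (∀ y : ℕ, pair0 y s.p1 s.q1 s.p2 s.q2 ≤ pair0 (y+1) s.p1 s.q1 s.p2 s.q2 ∧ pair1 y s.p1 s.q1 s.p2 s.q2 ≤ pair1 (y+1) s.p1 s.q1 s.p2 s.q2 ∧ pair2 y s.p1 s.q1 s.p2 s.q2 ≤ pair2 (y+1) s.p1 s.q1 s.p2 s.q2 ∧ pair3 y s.p1 s.q1 s.p2 s.q2 ≤ pair3 (y+1) s.p1 s.q1 s.p2 s.q2 ∧ pair4 y s.p1 s.q1 s.p2 s.q2 ≤ pair4 (y+1)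 s.p1 s.q1 s.p2 s.q2))) (a : ℕ) : ((0 ≤ (step a s).t ∧ 0 ≤ aW (step a s) ∧ ∀ y : ℕ, 0 ≤ pair0 y (step a s).p1 (step a s).q1 (step a s).p2 (step a s).q2 ∧ 0 ≤ pair1 y (step a s).p1 (step a s).q1 (step a s).p2 (step a s).q2 ∧ 0 ≤ pair2 y (step a s).p1 (step a s).q1 (step a s).p2 (step a s).q2 ∧ 0 ≤ pair3 y (step a s).p1 (step a s).q1 (step a s).p2 (step a s).q2 ∧ 0 ≤ pair4 y (step a s).p1 (step a s).q1 (step a s).p2 (step a s).q2) ∧ (∀ y : ℕ, pair0 y (step a s).p1 (step a s).q1 (step a s).p2 (step a s).q2 ≤ pair0 (y+1) (step a s).p1 (step a s).q1 (step a s).p2 (step a s).q2 ∧ pair1 y (step a s).p1 (step a s).q1 (step a s).p2 (step a s).q2 ≤ pair1 (y+1) (step a s).p1 (step a s).q1 (step a s).p2 (step a s).q2 ∧ pair2 y (step a s).p1 (step a s).q1 (step a s).p2 (step a s).q2 ≤ pair2 (y+1) (step a s).p1 (step a s).q1 (step a s).p2 (step a s).q2 ∧ pair3 y (step a s).p1 (step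 a s).q1 (step a s).p2 (step a s).q2 ≤ pair3 (y+1) (step a s).p1 (step a s).q1 (step a s).p2 (step a s).q2 ∧ pair4 y (step a s).p1 (step a s).q1 (step a s).p2 (step a s).q2 ≤ pair4 (y+1) (step a s).p1 (step a s).q1 (step a s).p2 (step a s).q2)) := by
  obtain ⟨hI, hM⟩ := h
  refine ⟨inv_state s hI a, fun y => ?_⟩
  obtain ⟨ht, -, -⟩ := hI
  obtain ⟨m0, m1, m2, m3, m4⟩ := hM y
  have h45 : (4:ℚ)^a ≤ (5:ℚ)^a := pow_le_pow_left₀ (by norm_num) (by norm_num) a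
  have h4n : (0:ℚ) ≤ (4:ℚ)^a := by positivity
  refine ⟨?_, ?_, ?_, ?_, ?_⟩
  · rw [P0_step a y s, P0_step a (y+1) s]
    have hk := K0_mono_y a y
    nlinarith [mul_le_mul_of_nonneg_left m0 (show (0:ℚ) ≤ ((1 : ℚ) * (4:ℚ)^a) by nlinarith [h45, h4n]), mul_le_mul_of_nonneg_left m1 (show (0:ℚ) ≤ ((1 : ℚ) * ((5:ℚ)^a - (4:ℚ)^a)) by nlinarith [h45, h4n]), mul_le_mul_of_nonneg_left m2 (show (0:ℚ) ≤ ((1 : ℚ) * (4:ℚ)^a) by nlinarith [h45, h4n]), mul_nonneg ht hk]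
  · rw [P1_step a y s, P1_step a (y+1) s]
    have hk := K1_mono_y a y
    nlinarith [mul_le_mul_of_nonneg_left m1 (show (0:ℚ) ≤ ((1 : ℚ) * (4:ℚ)^a + (3 : ℚ) * ((5:ℚ)^a - (4:ℚ)^a)) by nlinarith [h45, h4n]), mul_le_mul_of_nonneg_left m3 (show (0:ℚ) ≤ ((1 : ℚ) * (4:ℚ)^a) by nlinarith [h45, h4n]), mul_nonneg ht hk]
  · rw [P2_step a y s, P2_step a (y+1) s]
    have hk := K2_mono_y a y
    nlinarith [mul_le_mul_of_nonneg_left m2 (show (0:ℚ) ≤ ((2 : ℚ) * (4:ℚ)^a) by nlinarith [h45, h4n]), mul_le_mul_of_nonneg_left m4 (show (0:ℚ) ≤ ((1 : ℚ) * ((5:ℚ)^a - (4:ℚ)^a)) by nlinarith [h45, h4n]), mul_nonneg ht hk]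
  · rw [P3_step a y s, P3_step a (y+1) s]
    have hk := K3_mono_y a y
    nlinarith [mul_le_mul_of_nonneg_left m1 (show (0:ℚ) ≤ ((4 : ℚ) * ((5:ℚ)^a - (4:ℚ)^a)) by nlinarith [h45, h4n]), mul_le_mul_of_nonneg_left m3 (show (0:ℚ) ≤ ((2 : ℚ) * (4:ℚ)^a) by nlinarith [h45, h4n]), mul_nonneg ht hk]
  · rw [P4_step a y s, P4_step a (y+1) s]
    have hk := K4_mono_y a y
    nlinarith [mul_le_mul_of_nonneg_left m2 (show (0:ℚ) ≤ ((4 : ℚ) * (4:ℚ)^a) by nlinarith [h45, h4n]), mul_le_mul_of_nonneg_left m4 (show (0:ℚ) ≤ ((1 : ℚ) * (4:ℚ)^a + (3 : ℚ) * ((5:ℚ)^a - (4:ℚ)^a)) by nlinarith [h45, h4n]), mul_nonneg ht hk]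

/-- `Inv⁺` propagates along `evalApp`. [this work] -/
theorem invP_evalApp (Y : List ℕ) (s : St) (h : ((0 ≤ s.t ∧ 0 ≤ aW s ∧ ∀ y : ℕ, 0 ≤ pair0 y s.p1 s.q1 s.p2 s.q2 ∧ 0 ≤ pair1 y s.p1 s.q1 s.p2 s.q2 ∧ 0 ≤ pair2 y s.p1 s.q1 s.p2 s.q2 ∧ 0 ≤ pair3 y s.p1 s.q1 s.p2 s.q2 ∧ 0 ≤ pair4 y s.p1 s.q1 s.p2 s.q2) ∧ (∀ y : ℕ, pair0 y s.p1 s.q1 s.p2 s.q2 ≤ pair0 (y+1) s.p1 s.q1 s.p2 s.q2 ∧ pair1 y s.p1 s.q1 s.p2 s.q2 ≤ pair1 (y+1) s.p1 s.q1 s.p2 s.q2 ∧ pair2 y s.p1 s.q1 s.p2 s.q2 ≤ pair2 (y+1) s.p1 s.q1 s.p2 s.q2 ∧ pair3 y s.p1 s.q1 s.p2 s.q2 ≤ pair3 (y+1) s.p1 s.q1 s.p2 s.q2 ∧ pair4 y s.p1 s.q1 s.p2 s.q2 ≤ pair4 (y+1) s.p1 s.q1 s.p2 s.q2))) : ((0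 ≤ (evalApp Y s).t ∧ 0 ≤ aW (evalApp Y s) ∧ ∀ y : ℕ, 0 ≤ pair0 y (evalApp Y s).p1 (evalApp Y s).q1 (evalApp Y s).p2 (evalApp Y s).q2 ∧ 0 ≤ pair1 y (evalApp Y s).p1 (evalApp Y s).q1 (evalApp Y s).p2 (evalApp Y s).q2 ∧ 0 ≤ pair2 y (evalApp Y s).p1 (evalApp Y s).q1 (evalApp Y s).p2 (evalApp Y s).q2 ∧ 0 ≤ pair3 y (evalApp Y s).p1 (evalApp Y s).q1 (evalApp Y s).p2 (evalApp Y s).q2 ∧ 0 ≤ pair4 y (evalApp Y s).p1 (evalApp Y s).q1 (evalApp Y s).p2 (evalApp Y s).q2) ∧ (∀ y : ℕ, pair0 y (evalApp Y s).p1 (evalApp Y s).q1 (evalApp Y s).p2 (evalApp Y s).q2 ≤ pair0 (y+1) (evalApp Y s).p1 (evalApp Y s).q1 (evalApp Y s).p2 (evalApp Y s).q2 ∧ pair1 y (evalApp Y s).p1 (evalApp Y s).q1 (evalApp Y s).p2 (evalApp Y s).q2 ≤ pair1 (y+1) (evalApp Y s).p1 (evalApp Y s).q1 (evalApp Y s).p2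 (evalApp Y s).q2 ∧ pair2 y (evalApp Y s).p1 (evalApp Y s).q1 (evalApp Y s).p2 (evalApp Y s).q2 ≤ pair2 (y+1) (evalApp Y s).p1 (evalApp Y s).q1 (evalApp Y s).p2 (evalApp Y s).q2 ∧ pair3 y (evalApp Y s).p1 (evalApp Y s).q1 (evalApp Y s).p2 (evalApp Y s).q2 ≤ pair3 (y+1) (evalApp Y s).p1 (evalApp Y s).q1 (evalApp Y s).p2 (evalApp Y s).q2 ∧ pair4 y (evalApp Y s).p1 (evalApp Y s).q1 (evalApp Y s).p2 (evalApp Y s).q2 ≤ pair4 (y+1) (evalApp Y s).p1 (evalApp Y s).q1 (evalApp Y s).p2 (evalApp Y s).q2)) := by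
  induction Y with
  | nil => exact h
  | cons y Y ih => exact invP_state _ ih y

/-- `Inv⁺` holds along every hub word (at `ω` all pairings vanish). [this work] -/
theorem invP_evalW (w : List ℕ) : ((0 ≤ (evalW w).t ∧ 0 ≤ aW (evalW w) ∧ ∀ y : ℕ, 0 ≤ pair0 y (evalW w).p1 (evalW w).q1 (evalW w).p2 (evalW w).q2 ∧ 0 ≤ pair1 y (evalW w).p1 (evalW w).q1 (evalW w).p2 (evalW w).q2 ∧ 0 ≤ pair2 y (evalW w).p1 (evalW w).q1 (evalW w).p2 (evalW w).q2 ∧ 0 ≤ pair3 y (evalW w).p1 (evalW w).q1 (evalW w).p2 (evalW w).q2 ∧ 0 ≤ pair4 y (evalW w).p1 (evalW w).q1 (evalW w).p2 (evalW w).q2) ∧ (∀ y : ℕ, pair0 y (evalW w).p1 (evalW w).q1 (evalW w).p2 (evalW w).q2 ≤ pair0 (y+1) (evalW w).p1 (evalW w).q1 (evalW w).p2 (evalW w).q2 ∧ pair1 y (evalW w).p1 (evalW w).q1 (evalW w).p2 (evalW w).q2 ≤ pair1 (y+1) (evalW w).p1 (evalW w).q1 (evalW w).p2 (evalW w).q2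 ∧ pair2 y (evalW w).p1 (evalW w).q1 (evalW w).p2 (evalW w).q2 ≤ pair2 (y+1) (evalW w).p1 (evalW w).q1 (evalW w).p2 (evalW w).q2 ∧ pair3 y (evalW w).p1 (evalW w).q1 (evalW w).p2 (evalW w).q2 ≤ pair3 (y+1) (evalW w).p1 (evalW w).q1 (evalW w).p2 (evalW w).q2 ∧ pair4 y (evalW w).p1 (evalW w).q1 (evalW w).p2 (evalW w).q2 ≤ pair4 (y+1) (evalW w).p1 (evalW w).q1 (evalW w).p2 (evalW w).q2)) := by
  induction w with
  | nil =>
    refine ⟨inv [], fun y => ?_⟩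
    simp only [evalW, omega, pair0, pair1, pair2, pair3, pair4, rho]
    norm_num
  | cons a w ih => exact invP_state _ ih a

/-- `Inv⁺` is preserved by `M(0) − I` (bare letter minus identity): on the U-blocks it is the amplitude `a₂`, `g_i·a₂ ∈ {a₂, g₁′, a₂, g₁′, 4a₂}`. [this work] -/
theorem invP_diff0 (s : St) (h : ((0 ≤ s.t ∧ 0 ≤ aW s ∧ ∀ y : ℕ, 0 ≤ pair0 y s.p1 s.q1 s.p2 s.q2 ∧ 0 ≤ pair1 y s.p1 s.q1 s.p2 s.q2 ∧ 0 ≤ pair2 y s.p1 s.q1 s.p2 s.q2 ∧ 0 ≤ pair3 y s.p1 s.q1 s.p2 s.q2 ∧ 0 ≤ pair4 y s.p1 s.q1 s.p2 s.q2) ∧ (∀ y : ℕ, pair0 y s.p1 s.q1 s.p2 s.q2 ≤ pair0 (y+1) s.p1 s.q1 s.p2 s.q2 ∧ pair1 y s.p1 s.q1 s.p2 s.q2 ≤ pair1 (y+1) s.p1 s.q1 s.p2 s.q2 ∧ pair2 y s.p1 s.q1 s.p2 s.q2 ≤ pair2 (y+1) s.p1 s.q1 s.p2 s.q2 ∧ pair3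 y s.p1 s.q1 s.p2 s.q2 ≤ pair3 (y+1) s.p1 s.q1 s.p2 s.q2 ∧ pair4 y s.p1 s.q1 s.p2 s.q2 ≤ pair4 (y+1) s.p1 s.q1 s.p2 s.q2))) : ((0 ≤ (sub (step 0 s) s).t ∧ 0 ≤ aW (sub (step 0 s) s) ∧ ∀ y : ℕ, 0 ≤ pair0 y (sub (step 0 s) s).p1 (sub (step 0 s) s).q1 (sub (step 0 s) s).p2 (sub (step 0 s) s).q2 ∧ 0 ≤ pair1 y (sub (step 0 s) s).p1 (sub (step 0 s) s).q1 (sub (step 0 s) s).p2 (sub (step 0 s) s).q2 ∧ 0 ≤ pair2 y (sub (step 0 s) s).p1 (sub (step 0 s) s).q1 (sub (step 0 s) s).p2 (sub (step 0 s) s).q2 ∧ 0 ≤ pair3 y (sub (step 0 s) s).p1 (sub (step 0 s) s).q1 (sub (step 0 s) s).p2 (sub (step 0 s) s).q2 ∧ 0 ≤ pair4 y (sub (step 0 s) s).p1 (sub (step 0 s) s).q1 (sub (step 0 s) s).p2 (sub (step 0 s) s).q2) ∧ (∀ y : ℕ, pair0 y (sub (step 0 s) s).p1 (sub (step 0 s)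 s).q1 (sub (step 0 s) s).p2 (sub (step 0 s) s).q2 ≤ pair0 (y+1) (sub (step 0 s) s).p1 (sub (step 0 s) s).q1 (sub (step 0 s) s).p2 (sub (step 0 s) s).q2 ∧ pair1 y (sub (step 0 s) s).p1 (sub (step 0 s) s).q1 (sub (step 0 s) s).p2 (sub (step 0 s) s).q2 ≤ pair1 (y+1) (sub (step 0 s) s).p1 (sub (step 0 s) s).q1 (sub (step 0 s) s).p2 (sub (step 0 s) s).q2 ∧ pair2 y (sub (step 0 s) s).p1 (sub (step 0 s) s).q1 (sub (step 0 s) s).p2 (sub (step 0 s) s).q2 ≤ pair2 (y+1) (sub (step 0 s) s).p1 (sub (step 0 s) s).q1 (sub (step 0 s) s).p2 (sub (step 0 s) s).q2 ∧ pair3 y (sub (step 0 s) s).p1 (sub (step 0 s) s).q1 (sub (step 0 s) s).p2 (sub (step 0 s) s).q2 ≤ pair3 (y+1) (sub (step 0 s) s).p1 (sub (step 0 s) s).q1 (sub (step 0 s) s).p2 (sub (step 0 s) s).q2 ∧ pair4 y (sub (step 0 s) s).p1 (sub (step 0 s) s).q1 (sub (step 0 s) s).p2 (sub (step 0 s) s).q2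 ≤ pair4 (y+1) (sub (step 0 s) s).p1 (sub (step 0 s) s).q1 (sub (step 0 s) s).p2 (sub (step 0 s) s).q2)) := by
  obtain ⟨hI, hM⟩ := h
  refine ⟨inv_diff0 s hI, fun y => ?_⟩
  obtain ⟨ht, -, -⟩ := hI
  obtain ⟨m0, m1, m2, m3, m4⟩ := hM y
  refine ⟨?_, ?_, ?_, ?_, ?_⟩
  · rw [pair0_sub, pair0_sub, P0_step 0 y s, P0_step 0 (y+1) s]
    simp only [pow_zero]
    have hk := K0_mono_y 0 y
    nlinarith [m0, m1, m2, m3, m4, mul_nonneg ht hk]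
  · rw [pair1_sub, pair1_sub, P1_step 0 y s, P1_step 0 (y+1) s]
    simp only [pow_zero]
    have hk := K1_mono_y 0 y
    nlinarith [m0, m1, m2, m3, m4, mul_nonneg ht hk]
  · rw [pair2_sub, pair2_sub, P2_step 0 y s, P2_step 0 (y+1) s]
    simp only [pow_zero]
    have hk := K2_mono_y 0 y
    nlinarith [m0, m1, m2, m3, m4, mul_nonneg ht hk]
  · rw [pair3_sub, pair3_sub, P3_step 0 y s, P3_step 0 (y+1) s]
    simp only [pow_zero]
    have hk := K3_mono_y 0 y
    nlinarith [m0, m1, m2, m3, m4, mul_nonneg ht hk]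
  · rw [pair4_sub, pair4_sub, P4_step 0 y s, P4_step 0 (y+1) s]
    simp only [pow_zero]
    have hk := K4_mono_y 0 y
    nlinarith [m0, m1, m2, m3, m4, mul_nonneg ht hk]

/-- `Inv⁺` is preserved by every increment `M(c+1) − M(c)`: the certificate coefficients `4^a`, `5^a − 4^a` are nondecreasing in `a`, and the jump
terms are controlled by (P2) `K_i(c+1,y) ≥ K_i(c,y)` and (P4) (mixed second differences). [this work] -/
theorem invP_delta (c : ℕ) (s : St) (h : ((0 ≤ s.t ∧ 0 ≤ aW s ∧ ∀ y : ℕ, 0 ≤ pair0 y s.p1 s.q1 s.p2 s.q2 ∧ 0 ≤ pair1 y s.p1 s.q1 s.p2 s.q2 ∧ 0 ≤ pair2 y s.p1 s.q1 s.p2 s.q2 ∧ 0 ≤ pair3 y s.p1 s.q1 s.p2 s.q2 ∧ 0 ≤ pair4 y s.p1 s.q1 s.p2 s.q2) ∧ (∀ y : ℕ, pair0 y s.p1 s.q1 s.p2 s.q2 ≤ pair0 (y+1) s.p1 s.q1 s.p2 s.q2 ∧ pair1 y s.p1 s.q1 s.p2 s.q2 ≤ pair1 (y+1) s.p1 s.q1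 s.p2 s.q2 ∧ pair2 y s.p1 s.q1 s.p2 s.q2 ≤ pair2 (y+1) s.p1 s.q1 s.p2 s.q2 ∧ pair3 y s.p1 s.q1 s.p2 s.q2 ≤ pair3 (y+1) s.p1 s.q1 s.p2 s.q2 ∧ pair4 y s.p1 s.q1 s.p2 s.q2 ≤ pair4 (y+1) s.p1 s.q1 s.p2 s.q2))) : ((0 ≤ (sub (step (c+1) s) (step c s)).t ∧ 0 ≤ aW (sub (step (c+1) s) (step c s)) ∧ ∀ y : ℕ, 0 ≤ pair0 y (sub (step (c+1) s) (step c s)).p1 (sub (step (c+1) s) (step c s)).q1 (sub (step (c+1) s) (step c s)).p2 (sub (step (c+1) s) (step c s)).q2 ∧ 0 ≤ pair1 y (sub (step (c+1) s) (step c s)).p1 (sub (step (c+1) s) (step c s)).q1 (sub (step (c+1) s) (step c s)).p2 (sub (step (c+1) s) (step c s)).q2 ∧ 0 ≤ pair2 y (sub (step (c+1) s) (step c s)).p1 (sub (step (c+1) s) (step c s)).q1 (sub (step (c+1) s) (step c s)).p2 (sub (step (c+1) s) (step c s)).q2 ∧ 0 ≤ pair3 y (sub (step (c+1) s) (step c s)).p1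 (sub (step (c+1) s) (step c s)).q1 (sub (step (c+1) s) (step c s)).p2 (sub (step (c+1) s) (step c s)).q2 ∧ 0 ≤ pair4 y (sub (step (c+1) s) (step c s)).p1 (sub (step (c+1) s) (step c s)).q1 (sub (step (c+1) s) (step c s)).p2 (sub (step (c+1) s) (step c s)).q2) ∧ (∀ y : ℕ, pair0 y (sub (step (c+1) s) (step c s)).p1 (sub (step (c+1) s) (step c s)).q1 (sub (step (c+1) s) (step c s)).p2 (sub (step (c+1) s) (step c s)).q2 ≤ pair0 (y+1) (sub (step (c+1) s) (step c s)).p1 (sub (step (c+1) s) (step c s)).q1 (sub (step (c+1) s) (step c s)).p2 (sub (step (c+1) s) (step c s)).q2 ∧ pair1 y (sub (step (c+1) s) (step c s)).p1 (sub (step (c+1) s) (step c s)).q1 (sub (step (c+1) s) (step c s)).p2 (sub (step (c+1) s) (step c s)).q2 ≤ pair1 (y+1) (sub (step (c+1) s) (step c s)).p1 (sub (step (c+1) s) (step c s)).q1 (sub (step (c+1) s) (step c s)).p2 (sub (step (c+1) s) (step c s)).q2 ∧ pair2 y (sub (step (c+1) s) (step c s)).p1 (sub (step (c+1) s) (step c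 s)).q1 (sub (step (c+1) s) (step c s)).p2 (sub (step (c+1) s) (step c s)).q2 ≤ pair2 (y+1) (sub (step (c+1) s) (step c s)).p1 (sub (step (c+1) s) (step c s)).q1 (sub (step (c+1) s) (step c s)).p2 (sub (step (c+1) s) (step c s)).q2 ∧ pair3 y (sub (step (c+1) s) (step c s)).p1 (sub (step (c+1) s) (step c s)).q1 (sub (step (c+1) s) (step c s)).p2 (sub (step (c+1) s) (step c s)).q2 ≤ pair3 (y+1) (sub (step (c+1) s) (step c s)).p1 (sub (step (c+1) s) (step c s)).q1 (sub (step (c+1) s) (step c s)).p2 (sub (step (c+1) s) (step c s)).q2 ∧ pair4 y (sub (step (c+1) s) (step c s)).p1 (sub (step (c+1) s) (step c s)).q1 (sub (step (c+1) s) (step c s)).p2 (sub (step (c+1) s) (step c s)).q2 ≤ pair4 (y+1) (sub (step (c+1) s) (step c s)).p1 (sub (step (c+1) s) (step c s)).q1 (sub (step (c+1) s) (step c s)).p2 (sub (step (c+1) s) (step c s)).q2)) := by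
  obtain ⟨hI, hM⟩ := h
  obtain ⟨ht, haw, hp⟩ := hI
  have h45 : (4:ℚ)^c ≤ (5:ℚ)^c := pow_le_pow_left₀ (by norm_num) (by norm_num) c
  have h4n : (0:ℚ) ≤ (4:ℚ)^c := by positivity
  have h2n : (0:ℚ) ≤ (2:ℚ)^c := by positivity
  refine ⟨⟨?_, ?_, fun y => ?_⟩, fun y => ?_⟩
  · simp only [sub, step, pow_succ]; nlinarith [mul_nonneg h2n ht]
  · rw [aW_sub, E_step, E_step, rho_eq_pair0, rho_eq_pair0]
    simp only [pow_succ]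
    obtain ⟨m0, -, -, -, -⟩ := hM c
    nlinarith [mul_nonneg h2n haw, m0, mul_le_mul_of_nonneg_left (S0_mono c) ht]
  · obtain ⟨g0, g1, g2, g3, g4⟩ := hp y
    refine ⟨?_, ?_, ?_, ?_, ?_⟩
    · rw [pair0_sub, P0_step (c+1) y s, P0_step c y s]
      simp only [pow_succ]
      have hk := K0_mono_a c y
      nlinarith [mul_nonneg (show (0:ℚ) ≤ (((1 : ℚ) * ((4:ℚ)^c * 4)) - ((1 : ℚ) * (4:ℚ)^c)) by nlinarith [h45, h4n]) g0, mul_nonneg (show (0:ℚ) ≤ (((1 : ℚ) * (((5:ℚ)^c * 5) - ((4:ℚ)^c * 4))) - ((1 : ℚ) * ((5:ℚ)^c - (4:ℚ)^c))) by nlinarith [h45, h4n]) g1, mul_nonneg (show (0:ℚ) ≤ (((1 : ℚ) * ((4:ℚ)^c * 4)) - ((1 : ℚ) * (4:ℚ)^c)) by nlinarith [h45, h4n]) g2, mul_nonneg ht hk]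
    · rw [pair1_sub, P1_step (c+1) y s, P1_step c y s]
      simp only [pow_succ]
      have hk := K1_mono_a c y
      nlinarith [mul_nonneg (show (0:ℚ) ≤ (((1 : ℚ) * ((4:ℚ)^c * 4) + (3 : ℚ) * (((5:ℚ)^c * 5) - ((4:ℚ)^c * 4))) - ((1 : ℚ) * (4:ℚ)^c + (3 : ℚ) * ((5:ℚ)^c - (4:ℚ)^c))) by nlinarith [h45, h4n]) g1, mul_nonneg (show (0:ℚ) ≤ (((1 : ℚ) * ((4:ℚ)^c * 4)) - ((1 : ℚ) * (4:ℚ)^c)) by nlinarith [h45, h4n]) g3, mul_nonneg ht hk]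
    · rw [pair2_sub, P2_step (c+1) y s, P2_step c y s]
      simp only [pow_succ]
      have hk := K2_mono_a c y
      nlinarith [mul_nonneg (show (0:ℚ) ≤ (((2 : ℚ) * ((4:ℚ)^c * 4)) - ((2 : ℚ) * (4:ℚ)^c)) by nlinarith [h45, h4n]) g2, mul_nonneg (show (0:ℚ) ≤ (((1 : ℚ) * (((5:ℚ)^c * 5) - ((4:ℚ)^c * 4))) - ((1 : ℚ) * ((5:ℚ)^c - (4:ℚ)^c))) by nlinarith [h45, h4n]) g4, mul_nonneg ht hk]
    · rw [pair3_sub, P3_step (c+1) y s, P3_step c y s]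
      simp only [pow_succ]
      have hk := K3_mono_a c y
      nlinarith [mul_nonneg (show (0:ℚ) ≤ (((4 : ℚ) * (((5:ℚ)^c * 5) - ((4:ℚ)^c * 4))) - ((4 : ℚ) * ((5:ℚ)^c - (4:ℚ)^c))) by nlinarith [h45, h4n]) g1, mul_nonneg (show (0:ℚ) ≤ (((2 : ℚ) * ((4:ℚ)^c * 4)) - ((2 : ℚ) * (4:ℚ)^c)) by nlinarith [h45, h4n]) g3, mul_nonneg ht hk]
    · rw [pair4_sub, P4_step (c+1) y s, P4_step c y s]
      simp only [pow_succ]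
      have hk := K4_mono_a c y
      nlinarith [mul_nonneg (show (0:ℚ) ≤ (((4 : ℚ) * ((4:ℚ)^c * 4)) - ((4 : ℚ) * (4:ℚ)^c)) by nlinarith [h45, h4n]) g2, mul_nonneg (show (0:ℚ) ≤ (((1 : ℚ) * ((4:ℚ)^c * 4) + (3 : ℚ) * (((5:ℚ)^c * 5) - ((4:ℚ)^c * 4))) - ((1 : ℚ) * (4:ℚ)^c + (3 : ℚ) * ((5:ℚ)^c - (4:ℚ)^c))) by nlinarith [h45, h4n]) g4, mul_nonneg ht hk]
  · obtain ⟨m0, m1, m2, m3, m4⟩ := hM y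
    refine ⟨?_, ?_, ?_, ?_, ?_⟩
    · rw [pair0_sub, pair0_sub, P0_step (c+1) y s, P0_step c y s, P0_step (c+1) (y+1) s, P0_step c (y+1) s]
      simp only [pow_succ]
      have hk := K0_mono_ay c y
      nlinarith [mul_le_mul_of_nonneg_left m0 (show (0:ℚ) ≤ (((1 : ℚ) * ((4:ℚ)^c * 4)) - ((1 : ℚ) * (4:ℚ)^c)) by nlinarith [h45, h4n]), mul_le_mul_of_nonneg_left m1 (show (0:ℚ) ≤ (((1 : ℚ) * (((5:ℚ)^c * 5) - ((4:ℚ)^c * 4))) - ((1 : ℚ) * ((5:ℚ)^c - (4:ℚ)^c))) by nlinarith [h45, h4n]), mul_le_mul_of_nonneg_left m2 (show (0:ℚ) ≤ (((1 : ℚ) * ((4:ℚ)^c * 4)) - ((1 : ℚ) * (4:ℚ)^c)) by nlinarith [h45, h4n]), mul_nonneg ht hk]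
    · rw [pair1_sub, pair1_sub, P1_step (c+1) y s, P1_step c y s, P1_step (c+1) (y+1) s, P1_step c (y+1) s]
      simp only [pow_succ]
      have hk := K1_mono_ay c y
      nlinarith [mul_le_mul_of_nonneg_left m1 (show (0:ℚ) ≤ (((1 : ℚ) * ((4:ℚ)^c * 4) + (3 : ℚ) * (((5:ℚ)^c * 5) - ((4:ℚ)^c * 4))) - ((1 : ℚ) * (4:ℚ)^c + (3 : ℚ) * ((5:ℚ)^c - (4:ℚ)^c))) by nlinarith [h45, h4n]), mul_le_mul_of_nonneg_left m3 (show (0:ℚ) ≤ (((1 : ℚ) * ((4:ℚ)^c * 4)) - ((1 : ℚ) * (4:ℚ)^c)) by nlinarith [h45, h4n]), mul_nonneg ht hk]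
    · rw [pair2_sub, pair2_sub, P2_step (c+1) y s, P2_step c y s, P2_step (c+1) (y+1) s, P2_step c (y+1) s]
      simp only [pow_succ]
      have hk := K2_mono_ay c y
      nlinarith [mul_le_mul_of_nonneg_left m2 (show (0:ℚ) ≤ (((2 : ℚ) * ((4:ℚ)^c * 4)) - ((2 : ℚ) * (4:ℚ)^c)) by nlinarith [h45, h4n]), mul_le_mul_of_nonneg_left m4 (show (0:ℚ) ≤ (((1 : ℚ) * (((5:ℚ)^c * 5) - ((4:ℚ)^c * 4))) - ((1 : ℚ) * ((5:ℚ)^c - (4:ℚ)^c))) by nlinarith [h45, h4n]), mul_nonneg ht hk]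
    · rw [pair3_sub, pair3_sub, P3_step (c+1) y s, P3_step c y s, P3_step (c+1) (y+1) s, P3_step c (y+1) s]
      simp only [pow_succ]
      have hk := K3_mono_ay c y
      nlinarith [mul_le_mul_of_nonneg_left m1 (show (0:ℚ) ≤ (((4 : ℚ) * (((5:ℚ)^c * 5) - ((4:ℚ)^c * 4))) - ((4 : ℚ) * ((5:ℚ)^c - (4:ℚ)^c))) by nlinarith [h45, h4n]), mul_le_mul_of_nonneg_left m3 (show (0:ℚ) ≤ (((2 : ℚ) * ((4:ℚ)^c * 4)) - ((2 : ℚ) * (4:ℚ)^c)) by nlinarith [h45, h4n]), mul_nonneg ht hk]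
    · rw [pair4_sub, pair4_sub, P4_step (c+1) y s, P4_step c y s, P4_step (c+1) (y+1) s, P4_step c (y+1) s]
      simp only [pow_succ]
      have hk := K4_mono_ay c y
      nlinarith [mul_le_mul_of_nonneg_left m2 (show (0:ℚ) ≤ (((4 : ℚ) * ((4:ℚ)^c * 4)) - ((4 : ℚ) * (4:ℚ)^c)) by nlinarith [h45, h4n]), mul_le_mul_of_nonneg_left m4 (show (0:ℚ) ≤ (((1 : ℚ) * ((4:ℚ)^c * 4) + (3 : ℚ) * (((5:ℚ)^c * 5) - ((4:ℚ)^c * 4))) - ((1 : ℚ) * (4:ℚ)^c + (3 : ℚ) * ((5:ℚ)^c - (4:ℚ)^c))) by nlinarith [h45, h4n]), mul_nonneg ht hk]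

/-- The `D₆`-increment functional is `≥ 0` from any `Inv⁺` state. [this work] -/
theorem G_nonneg (Y : List ℕ) (c : ℕ) (s : St) (h : ((0 ≤ s.t ∧ 0 ≤ aW s ∧ ∀ y : ℕ, 0 ≤ pair0 y s.p1 s.q1 s.p2 s.q2 ∧ 0 ≤ pair1 y s.p1 s.q1 s.p2 s.q2 ∧ 0 ≤ pair2 y s.p1 s.q1 s.p2 s.q2 ∧ 0 ≤ pair3 y s.p1 s.q1 s.p2 s.q2 ∧ 0 ≤ pair4 y s.p1 s.q1 s.p2 s.q2) ∧ (∀ y : ℕ, pair0 y s.p1 s.q1 s.p2 s.q2 ≤ pair0 (y+1) s.p1 s.q1 s.p2 s.q2 ∧ pair1 y s.p1 s.q1 s.p2 s.q2 ≤ pair1 (y+1) s.p1 s.q1 s.p2 s.q2 ∧ pair2 y s.p1 s.q1 s.p2 s.q2 ≤ pair2 (y+1) s.p1 s.q1 s.p2 s.q2 ∧ pair3 y s.p1 s.q1 s.p2 s.q2 ≤ pair3 (y+1) s.p1 s.q1 s.p2 s.q2 ∧ pair4 y s.p1 s.q1 s.p2 s.q2 ≤ pair4 (y+1) s.p1 s.q1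 s.p2 s.q2))) : 0 ≤ alphaF (evalApp Y (sub (step (c+1) s) (step c s))) :=
  alphaF_nonneg_of_invP _ (invP_evalApp Y _ (invP_delta c s h))

/-- The `D₆`-increment in one letter as the functional `α` of the increment state. [this work] -/
theorem D6_incr (Y : List ℕ) (c : ℕ) (Z : List ℕ) :
    D6 (Y ++ (c+1) :: Z) - D6 (Y ++ c :: Z) = alphaF (evalApp Y (sub (step (c+1) (evalW Z)) (step c (evalW Z)))) := by
  rw [D6, D6, evalW_append, evalW_append, evalApp_sub, alphaF_sub]
  simp only [evalW]

/-- Raising a letter raises `Σ` by one. [this work] -/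
theorem sum_incr (Y : List ℕ) (c : ℕ) (Z : List ℕ) : (Y ++ (c+1) :: Z).sum = (Y ++ c :: Z).sum + 1 := by
  simp only [List.sum_append, List.sum_cons]; omega

/-- THEOREM M for `Σ ≥ 5`: there the elementary part `6·5^Σ − 18·4^Σ` of the increment is already `≥ 0`. [this work] -/
theorem D_mono_of_five_le (Y : List ℕ) (c : ℕ) (Z : List ℕ) (h : 5 ≤ (Y ++ c :: Z).sum) : D (Y ++ c :: Z) ≤ D (Y ++ (c+1) :: Z) := by
  obtain ⟨m, hm⟩ := Nat.exists_eq_add_of_le h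
  have h6 := D6_incr Y c Z
  have hG := G_nonneg Y c (evalW Z) (invP_evalW Z)
  have h45 : (4:ℚ)^m ≤ (5:ℚ)^m := pow_le_pow_left₀ (by norm_num) (by norm_num) m
  have h4n : (0:ℚ) ≤ (4:ℚ)^m := by positivity
  unfold D
  rw [sum_incr, hm, pow_succ, pow_succ, pow_add, pow_add]
  nlinarith [h6, hG, h45, h4n]

/-- Inserting a bare vertex to the LEFT of the raised letter does not lower the increment. [this work] -/
theorem incr_zeroY (Y1 Y2 : List ℕ) (c : ℕ) (Z : List ℕ) :
    D ((Y1 ++ Y2) ++ (c+1) :: Z) - D ((Y1 ++ Y2) ++ c :: Z) ≤ D ((Y1 ++ 0 :: Y2) ++ (c+1) :: Z) - D ((Y1 ++ 0 :: Y2) ++ c :: Z) := by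
  have e1 := D6_incr (Y1 ++ Y2) c Z
  have e2 := D6_incr (Y1 ++ 0 :: Y2) c Z
  rw [evalApp_append] at e1 e2
  simp only [evalApp] at e2
  have hu : ((0 ≤ (evalApp Y2 (sub (step (c+1) (evalW Z)) (step c (evalW Z)))).t ∧ 0 ≤ aW (evalApp Y2 (sub (step (c+1) (evalW Z)) (step c (evalW Z)))) ∧ ∀ y : ℕ, 0 ≤ pair0 y (evalApp Y2 (sub (step (c+1) (evalW Z)) (step c (evalW Z)))).p1 (evalApp Y2 (sub (step (c+1) (evalW Z)) (step c (evalW Z)))).q1 (evalApp Y2 (sub (step (c+1) (evalW Z)) (step c (evalW Z)))).p2 (evalApp Y2 (sub (step (c+1) (evalW Z)) (step c (evalW Z)))).q2 ∧ 0 ≤ pair1 y (evalApp Y2 (sub (step (c+1) (evalW Z)) (step c (evalW Z)))).p1 (evalApp Y2 (sub (step (c+1) (evalW Z)) (step c (evalW Z)))).q1 (evalApp Y2 (sub (step (c+1) (evalW Z)) (step c (evalW Z)))).p2 (evalApp Y2 (sub (step (c+1) (evalW Z)) (step c (evalW Z)))).q2 ∧ 0 ≤ pair2 y (evalApp Y2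 (sub (step (c+1) (evalW Z)) (step c (evalW Z)))).p1 (evalApp Y2 (sub (step (c+1) (evalW Z)) (step c (evalW Z)))).q1 (evalApp Y2 (sub (step (c+1) (evalW Z)) (step c (evalW Z)))).p2 (evalApp Y2 (sub (step (c+1) (evalW Z)) (step c (evalW Z)))).q2 ∧ 0 ≤ pair3 y (evalApp Y2 (sub (step (c+1) (evalW Z)) (step c (evalW Z)))).p1 (evalApp Y2 (sub (step (c+1) (evalW Z)) (step c (evalW Z)))).q1 (evalApp Y2 (sub (step (c+1) (evalW Z)) (step c (evalW Z)))).p2 (evalApp Y2 (sub (step (c+1) (evalW Z)) (step c (evalW Z)))).q2 ∧ 0 ≤ pair4 y (evalApp Y2 (sub (step (c+1) (evalW Z)) (step c (evalW Z)))).p1 (evalApp Y2 (sub (step (c+1) (evalW Z)) (step c (evalW Z)))).q1 (evalApp Y2 (sub (step (c+1) (evalW Z)) (step c (evalW Z)))).p2 (evalApp Y2 (sub (step (c+1) (evalW Z)) (step c (evalW Z)))).q2) ∧ (∀ y : ℕ, pair0 y (evalApp Y2 (sub (step (c+1) (evalW Z)) (step c (evalW Z)))).p1 (evalApp Y2 (sub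 (step (c+1) (evalW Z)) (step c (evalW Z)))).q1 (evalApp Y2 (sub (step (c+1) (evalW Z)) (step c (evalW Z)))).p2 (evalApp Y2 (sub (step (c+1) (evalW Z)) (step c (evalW Z)))).q2 ≤ pair0 (y+1) (evalApp Y2 (sub (step (c+1) (evalW Z)) (step c (evalW Z)))).p1 (evalApp Y2 (sub (step (c+1) (evalW Z)) (step c (evalW Z)))).q1 (evalApp Y2 (sub (step (c+1) (evalW Z)) (step c (evalW Z)))).p2 (evalApp Y2 (sub (step (c+1) (evalW Z)) (step c (evalW Z)))).q2 ∧ pair1 y (evalApp Y2 (sub (step (c+1) (evalW Z)) (step c (evalW Z)))).p1 (evalApp Y2 (sub (step (c+1) (evalW Z)) (step c (evalW Z)))).q1 (evalApp Y2 (sub (step (c+1) (evalW Z)) (step c (evalW Z)))).p2 (evalApp Y2 (sub (step (c+1) (evalW Z)) (step c (evalW Z)))).q2 ≤ pair1 (y+1) (evalApp Y2 (sub (step (c+1) (evalW Z)) (step c (evalW Z)))).p1 (evalApp Y2 (sub (step (c+1) (evalW Z)) (step c (evalW Z)))).q1 (evalApp Y2 (sub (step (c+1) (evalW Z)) (step c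 (evalW Z)))).p2 (evalApp Y2 (sub (step (c+1) (evalW Z)) (step c (evalW Z)))).q2 ∧ pair2 y (evalApp Y2 (sub (step (c+1) (evalW Z)) (step c (evalW Z)))).p1 (evalApp Y2 (sub (step (c+1) (evalW Z)) (step c (evalW Z)))).q1 (evalApp Y2 (sub (step (c+1) (evalW Z)) (step c (evalW Z)))).p2 (evalApp Y2 (sub (step (c+1) (evalW Z)) (step c (evalW Z)))).q2 ≤ pair2 (y+1) (evalApp Y2 (sub (step (c+1) (evalW Z)) (step c (evalW Z)))).p1 (evalApp Y2 (sub (step (c+1) (evalW Z)) (step c (evalW Z)))).q1 (evalApp Y2 (sub (step (c+1) (evalW Z)) (step c (evalW Z)))).p2 (evalApp Y2 (sub (step (c+1) (evalW Z)) (step c (evalW Z)))).q2 ∧ pair3 y (evalApp Y2 (sub (step (c+1) (evalW Z)) (step c (evalW Z)))).p1 (evalApp Y2 (sub (step (c+1) (evalW Z)) (step c (evalW Z)))).q1 (evalApp Y2 (sub (step (c+1) (evalW Z)) (step c (evalW Z)))).p2 (evalApp Y2 (sub (step (c+1) (evalW Z)) (step c (evalW Z)))).q2 ≤ pair3 (y+1)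 (evalApp Y2 (sub (step (c+1) (evalW Z)) (step c (evalW Z)))).p1 (evalApp Y2 (sub (step (c+1) (evalW Z)) (step c (evalW Z)))).q1 (evalApp Y2 (sub (step (c+1) (evalW Z)) (step c (evalW Z)))).p2 (evalApp Y2 (sub (step (c+1) (evalW Z)) (step c (evalW Z)))).q2 ∧ pair4 y (evalApp Y2 (sub (step (c+1) (evalW Z)) (step c (evalW Z)))).p1 (evalApp Y2 (sub (step (c+1) (evalW Z)) (step c (evalW Z)))).q1 (evalApp Y2 (sub (step (c+1) (evalW Z)) (step c (evalW Z)))).p2 (evalApp Y2 (sub (step (c+1) (evalW Z)) (step c (evalW Z)))).q2 ≤ pair4 (y+1) (evalApp Y2 (sub (step (c+1) (evalW Z)) (step c (evalW Z)))).p1 (evalApp Y2 (sub (step (c+1) (evalW Z)) (step c (evalW Z)))).q1 (evalApp Y2 (sub (step (c+1) (evalW Z)) (step c (evalW Z)))).p2 (evalApp Y2 (sub (step (c+1) (evalW Z)) (step c (evalW Z)))).q2)) := invP_evalApp Y2 _ (invP_delta c (evalW Z) (invP_evalW Z))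
  have hpos : 0 ≤ alphaF (evalApp Y1 (sub (step 0 (evalApp Y2 (sub (step (c+1) (evalW Z)) (step c (evalW Z))))) (evalApp Y2 (sub (step (c+1) (evalW Z)) (step c (evalW Z)))))) :=
    alphaF_nonneg_of_invP _ (invP_evalApp Y1 _ (invP_diff0 _ hu))
  rw [evalApp_sub, alphaF_sub] at hpos
  have hs1 : ((Y1 ++ 0 :: Y2) ++ (c+1) :: Z).sum = ((Y1 ++ Y2) ++ (c+1) :: Z).sum := by
    simp only [List.sum_append, List.sum_cons]; omega
  have hs2 : ((Y1 ++ 0 :: Y2) ++ c :: Z).sum = ((Y1 ++ Y2) ++ c :: Z).sum := by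
    simp only [List.sum_append, List.sum_cons]; omega
  unfold D; rw [hs1, hs2]; linarith

/-- Inserting a bare vertex to the RIGHT of the raised letter does not lower the increment (linearity of the increment operator). [this work] -/
theorem incr_zeroZ (Y : List ℕ) (c : ℕ) (Z1 Z2 : List ℕ) :
    D (Y ++ (c+1) :: (Z1 ++ Z2)) - D (Y ++ c :: (Z1 ++ Z2)) ≤ D (Y ++ (c+1) :: (Z1 ++ 0 :: Z2)) - D (Y ++ c :: (Z1 ++ 0 :: Z2)) := by
  have e1 := D6_incr Y c (Z1 ++ Z2)
  have e2 := D6_incr Y c (Z1 ++ 0 :: Z2)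
  rw [evalW_append] at e1 e2
  simp only [evalW] at e2
  have he : ((0 ≤ (evalApp Z1 (sub (step 0 (evalW Z2)) (evalW Z2))).t ∧ 0 ≤ aW (evalApp Z1 (sub (step 0 (evalW Z2)) (evalW Z2))) ∧ ∀ y : ℕ, 0 ≤ pair0 y (evalApp Z1 (sub (step 0 (evalW Z2)) (evalW Z2))).p1 (evalApp Z1 (sub (step 0 (evalW Z2)) (evalW Z2))).q1 (evalApp Z1 (sub (step 0 (evalW Z2)) (evalW Z2))).p2 (evalApp Z1 (sub (step 0 (evalW Z2)) (evalW Z2))).q2 ∧ 0 ≤ pair1 y (evalApp Z1 (sub (step 0 (evalW Z2)) (evalW Z2))).p1 (evalApp Z1 (sub (step 0 (evalW Z2)) (evalW Z2))).q1 (evalApp Z1 (sub (step 0 (evalW Z2)) (evalW Z2))).p2 (evalApp Z1 (sub (step 0 (evalW Z2)) (evalW Z2))).q2 ∧ 0 ≤ pair2 y (evalApp Z1 (sub (step 0 (evalW Z2)) (evalW Z2))).p1 (evalApp Z1 (sub (step 0 (evalW Z2)) (evalW Z2))).q1 (evalApp Z1 (sub (step 0 (evalW Z2)) (evalW Z2))).p2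 (evalApp Z1 (sub (step 0 (evalW Z2)) (evalW Z2))).q2 ∧ 0 ≤ pair3 y (evalApp Z1 (sub (step 0 (evalW Z2)) (evalW Z2))).p1 (evalApp Z1 (sub (step 0 (evalW Z2)) (evalW Z2))).q1 (evalApp Z1 (sub (step 0 (evalW Z2)) (evalW Z2))).p2 (evalApp Z1 (sub (step 0 (evalW Z2)) (evalW Z2))).q2 ∧ 0 ≤ pair4 y (evalApp Z1 (sub (step 0 (evalW Z2)) (evalW Z2))).p1 (evalApp Z1 (sub (step 0 (evalW Z2)) (evalW Z2))).q1 (evalApp Z1 (sub (step 0 (evalW Z2)) (evalW Z2))).p2 (evalApp Z1 (sub (step 0 (evalW Z2)) (evalW Z2))).q2) ∧ (∀ y : ℕ, pair0 y (evalApp Z1 (sub (step 0 (evalW Z2)) (evalW Z2))).p1 (evalApp Z1 (sub (step 0 (evalW Z2)) (evalW Z2))).q1 (evalApp Z1 (sub (step 0 (evalW Z2)) (evalW Z2))).p2 (evalApp Z1 (sub (step 0 (evalW Z2)) (evalW Z2))).q2 ≤ pair0 (y+1) (evalApp Z1 (sub (step 0 (evalW Z2)) (evalW Z2))).p1 (evalApp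 Z1 (sub (step 0 (evalW Z2)) (evalW Z2))).q1 (evalApp Z1 (sub (step 0 (evalW Z2)) (evalW Z2))).p2 (evalApp Z1 (sub (step 0 (evalW Z2)) (evalW Z2))).q2 ∧ pair1 y (evalApp Z1 (sub (step 0 (evalW Z2)) (evalW Z2))).p1 (evalApp Z1 (sub (step 0 (evalW Z2)) (evalW Z2))).q1 (evalApp Z1 (sub (step 0 (evalW Z2)) (evalW Z2))).p2 (evalApp Z1 (sub (step 0 (evalW Z2)) (evalW Z2))).q2 ≤ pair1 (y+1) (evalApp Z1 (sub (step 0 (evalW Z2)) (evalW Z2))).p1 (evalApp Z1 (sub (step 0 (evalW Z2)) (evalW Z2))).q1 (evalApp Z1 (sub (step 0 (evalW Z2)) (evalW Z2))).p2 (evalApp Z1 (sub (step 0 (evalW Z2)) (evalW Z2))).q2 ∧ pair2 y (evalApp Z1 (sub (step 0 (evalW Z2)) (evalW Z2))).p1 (evalApp Z1 (sub (step 0 (evalW Z2)) (evalW Z2))).q1 (evalApp Z1 (sub (step 0 (evalW Z2)) (evalW Z2))).p2 (evalApp Z1 (sub (step 0 (evalW Z2)) (evalW Z2))).q2 ≤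 pair2 (y+1) (evalApp Z1 (sub (step 0 (evalW Z2)) (evalW Z2))).p1 (evalApp Z1 (sub (step 0 (evalW Z2)) (evalW Z2))).q1 (evalApp Z1 (sub (step 0 (evalW Z2)) (evalW Z2))).p2 (evalApp Z1 (sub (step 0 (evalW Z2)) (evalW Z2))).q2 ∧ pair3 y (evalApp Z1 (sub (step 0 (evalW Z2)) (evalW Z2))).p1 (evalApp Z1 (sub (step 0 (evalW Z2)) (evalW Z2))).q1 (evalApp Z1 (sub (step 0 (evalW Z2)) (evalW Z2))).p2 (evalApp Z1 (sub (step 0 (evalW Z2)) (evalW Z2))).q2 ≤ pair3 (y+1) (evalApp Z1 (sub (step 0 (evalW Z2)) (evalW Z2))).p1 (evalApp Z1 (sub (step 0 (evalW Z2)) (evalW Z2))).q1 (evalApp Z1 (sub (step 0 (evalW Z2)) (evalW Z2))).p2 (evalApp Z1 (sub (step 0 (evalW Z2)) (evalW Z2))).q2 ∧ pair4 y (evalApp Z1 (sub (step 0 (evalW Z2)) (evalW Z2))).p1 (evalApp Z1 (sub (step 0 (evalW Z2)) (evalW Z2))).q1 (evalApp Z1 (sub (step 0 (evalW Z2)) (evalW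 Z2))).p2 (evalApp Z1 (sub (step 0 (evalW Z2)) (evalW Z2))).q2 ≤ pair4 (y+1) (evalApp Z1 (sub (step 0 (evalW Z2)) (evalW Z2))).p1 (evalApp Z1 (sub (step 0 (evalW Z2)) (evalW Z2))).q1 (evalApp Z1 (sub (step 0 (evalW Z2)) (evalW Z2))).p2 (evalApp Z1 (sub (step 0 (evalW Z2)) (evalW Z2))).q2)) := invP_evalApp Z1 _ (invP_diff0 _ (invP_evalW Z2))
  have hpos := G_nonneg Y c _ he
  rw [evalApp_sub Z1, delta_sub, evalApp_sub Y, alphaF_sub] at hpos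
  have hs1 : (Y ++ (c+1) :: (Z1 ++ 0 :: Z2)).sum = (Y ++ (c+1) :: (Z1 ++ Z2)).sum := by
    simp only [List.sum_append, List.sum_cons]; omega
  have hs2 : (Y ++ c :: (Z1 ++ 0 :: Z2)).sum = (Y ++ c :: (Z1 ++ Z2)).sum := by
    simp only [List.sum_append, List.sum_cons]; omega
  unfold D; rw [hs1, hs2]; linarith

end Summit.CriticalPhenomena.PercolationContinuityZ3.Theorems.ProductFormHubWords
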